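import Summits.BirchSwinnertonDyer.BirchSwinnertonDyer.Theorems.PrintCFramBottomClassIndexLawFiveLeEisensteinAnalyticInequalitySockets
import Summits.BirchSwinnertonDyer.BirchSwinnertonDyer.Theorems.PrintCFramBottomClassIndexLawFiveLeEisensteinEndStatePrints7
import HarnessLib

/-!
# Route `PrintCFram`, crux C2 `BottomClassIndexLawFiveLe` (stmt-BirchSwinnertonDyer-20372), line
# `eisenstein-resource-bdp-line`, skeleton v5 (sha16 7cebfbb25b86fbb6): the KOLYVAGIN-SIDE END STATE —
# the registered Eisenstein stub β1 `stub_flatEisensteinIncl_cmRamified` is implied by the UPPER (Euler-system) inclusion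
# together with ONE unit coefficient of the ♭-BDP frame in degree `≤ λ(X_(∅,0))`, and so is the crux
# (cell `bsd-print-cfram`, width seat `bsd-line-cfram-p1-w4` g0; helper `--supports` 20372; THEOREMS ONLY, 0 defs, 0 facts)

HONEST FRAMING. Nothing about BSD is proved; no registered stub is closed. The file closes a square left open by the LEAD's
`…EisensteinAnalyticInequalitySockets` (p625921: the registered analytic stub (AN) ⟸ the UPPER ♭-(∅,0) inclusion
`(Q) ⊆ Ch_Λ(X_(∅,0))·𝓞_{ℂ_p}⟦T⟧`): here the OTHER registered research stub, the Eisenstein inclusion β1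
`Ch_Λ(X_(∅,0))·𝓞_{ℂ_p}⟦T⟧ ⊆ (Q)`, is shown to follow from the SAME upper inclusion plus the reverse analytic inequality
(AN′) «some coefficient `Q_m` with `m ≤ λ(X_(∅,0))` is a unit» — i.e. from the data of the printed
Castella–Grossi–Lee–Skinner method (ONE Kolyvagin divisibility + the exact match of Iwasawa invariants ⟹ equality), with NO
Eisenstein-ideal / lattice-construction input at all.

* §1 (generic, over `𝓞_{ℂ_p}⟦T⟧`, for a finitely generated torsion `Λ = ℤ_p⟦T⟧`-module `X` and `Q ∈ 𝓞_{ℂ_p}⟦T⟧`):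
  `map_charIdeal_le_span_of_span_le_of_norm_coeff_eq_one` — UPPER `(Q) ⊆ Ch_Λ(X)·𝓞_{ℂ_p}⟦T⟧` ∧ (AN′)
  `∃ m ≤ λ(X), ‖Q_m‖ = 1` ⟹ LOWER `Ch_Λ(X)·𝓞_{ℂ_p}⟦T⟧ ⊆ (Q)` (hence equality,
  `map_charIdeal_eq_span_of_span_le_of_norm_coeff_eq_one`). Mechanism: `Ch_Λ(X) = (p^{μ} g₀)` with `ord ḡ₀ = λ(X)`
  (tree `exists_charIdeal_eq_span_C_pow_mu_mul`, Washington §13.2), so `λ(X) ≤ ord (p^μ g₀)‾ ≤ ord Q̄ ≤ m ≤ λ(X)`: the two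
  residual orders agree and `Q̄ ≠ 0`, and a divisor with the same residual order is an associate
  (`Literature.RingTheory.PowerSeries.span_singleton_le_of_le_of_order_map_residue_eq`). No `μ(X) = 0` hypothesis is needed
  (it FOLLOWS: `order_map_residue_eq_lambdaInvariant_of_span_le_of_norm_coeff_eq_one` gives `ord Q̄ = λ(X)`, and under UPPER the
  unit coefficient is necessarily the `λ(X)`-th one, `norm_coeff_lambdaInvariant_eq_one_of_span_le_of_norm_coeff_eq_one`).
  `exists_norm_coeff_eq_one_of_congr_of_order_le` — (AN′) ⟸ the MIRROR Greenberg–Vatsal data: a congruence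
  `Q ≡ u·L₁·L₂ (mod 𝔪)` with a unit `u`, residual-order UPPER bounds `ord L̄ᵢ ≤ nᵢ` and `n₁ + n₂ ≤ λ(X)`.
* §2 (on the crux binders, every CM-ramified row / Heegner field / anticyclotomic frame / ♭-BDP frame):
  `stub_flatEisensteinIncl_cmRamified_of_upperIncl_of_unitCoeff` — REGISTERED β1 VERBATIM ⟸ UPPER ∧ (AN′) (β1 carries its
  own torsion guard; finite generation of `X_(∅,0)` is the tree's `moduleFinite_XAc_empty`);
  `unitCoeff_cmRamified_of_GVMirror` — (AN′) on the binders ⟸ the mirror GV data at every frame;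
  `bottomClassIndexLawFiveLe_of_prints_of_prop14_of_upperIncl_of_unitCoeff` — END STATE: the crux
  `PrintCFram.BottomClassIndexLawFiveLe` BY NAME ⟸ the seven refereed facts of `stub_prints` (v5) ∧ CGLS Prop. 14 ∧ UPPER ∧ (AN′),
  through the LEAD's v5 end state (p626319) fed with β1 from this file and (AN) from p625921 (so the `hEq` socket of the row kernel,
  the ♭-IMC EQUALITY, holds at every frame); `…_of_GVMirror` — the same with (AN′) displayed as the mirror GV data.
READING. On the CM-ramified rows the crux therefore needs NO Eisenstein-side engine: its beyond-print content can be booked as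
{UPPER = the Heegner-point Kolyvagin-system divisibility for `f_W/K''` read on the (∅,0) line at the additive split `p`
(CGLS Thm. 3.2.1 + the Λ-adic BDP explicit reciprocity law at `p² ∣ N`, [BKNO 2026 §1.4] deferred),
(AN′) = `λ_an ≤ λ_alg` (the (an-inv) congruence + Rubin's `GL₁` EQUALITY for the two characters + the EXACT residual devissage
`λ(X_(∅,0)) = λ(χ) + λ(χω_K)`, CGLS §1.2 Prop. 14 / §3.3)} instead of {β1, (AN)}. Which pair is cheaper is the planner's call;
this file only proves the implications. THEOREMS ONLY; no definition, no named fact, no `sorry`. BSD is not proved by any of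
this; no summit statement is proved by this seat.

References: [CastellaGrossiLeeSkinner2022] Thm. 3.2.1, §3.3, proof of Thm. 5.1.1 (arXiv:2008.02571 pp. 4, 23);
[GreenbergVatsal2000] §1 (1)–(2), Thm. (1.3); [Washington1997] §13.2; [BurungaleKobayashiNakamuraOta2026] §1.4.
-/

set_option autoImplicit false
-- `…BirchSwinnertonDyer.BirchSwinnertonDyer.Theorems…` is the problem's mandated namespace (D-0017).
set_option linter.dupNamespace false

noncomputable section

open scoped Classical

namespace Summit.BirchSwinnertonDyer.BirchSwinnertonDyer.Theorems.PrintCFram.EisensteinKolyvaginSide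

open WeierstrassCurve NumberField IsDedekindDomain Field PowerSeries IsLocalRing
  Literature.NumberTheory.EllipticCurves Literature.NumberTheory.EllipticCurves.GreenbergSelmer
  Literature.NumberTheory.EllipticCurves.ModularForms Literature.NumberTheory.EllipticCurves.Rank1Residual IwasawaAlgebra
  Literature.NumberTheory.GaloisRepresentations Literature.NumberTheory.GaloisCohomology
  Summit.BirchSwinnertonDyer.BirchSwinnertonDyer.Theses.UniversalToricDescent
  Summit.BirchSwinnertonDyer.BirchSwinnertonDyer.Theorems.SchneiderFree
  Summit.BirchSwinnertonDyer.Rank1Residual Summit.BirchSwinnertonDyer.Rank1Residual.X11b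
  Summit.BirchSwinnertonDyer.Rank1Residual.X11b.AcSelmer
  Summit.BirchSwinnertonDyer.BirchSwinnertonDyer.Theorems.PrintCFram.EisensteinMatchAnatomy
  Summit.BirchSwinnertonDyer.BirchSwinnertonDyer.Theorems.PrintCFram.EisensteinResourceBdpLine

/-! ## §1 Generic: the upper inclusion plus one unit coefficient in degree `≤ λ(X)` gives the lower inclusion -/

section Generic

variable {p : ℕ} [Fact p.Prime]

/-- **Residual orders under UPPER ∧ (AN′).** For a finitely generated torsion `Λ = ℤ_p⟦T⟧`-module `X`, write
`Ch_Λ(X) = (C(p^{μ(X)})·g₀)` with `ord ḡ₀ = λ(X)` (Washington §13.2). If `(Q) ⊆ Ch_Λ(X)·𝓞_{ℂ_p}⟦T⟧` and some coefficient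
`Q_m`, `m ≤ λ(X)`, has norm `1`, then the reduction `Q̄ ∈ 𝔽̄_p⟦T⟧` is non-zero and BOTH `ord Q̄` and the residual order of the
image of the characteristic generator equal `λ(X)` (squeeze `λ(X) ≤ ord(p^μ g₀)‾ ≤ ord Q̄ ≤ m ≤ λ(X)`).
[cite: Washington1997, §13.2] [cite: GreenbergVatsal2000, §1 p. 18, (1)–(2)] -/
theorem order_map_residue_eq_of_span_le_of_norm_coeff_eq_one (X : Type*) [AddCommGroup X]
    [Module (IwasawaAlgebra p) X] [Module.Finite (IwasawaAlgebra p) X] (hX : Module.IsTorsion (IwasawaAlgebra p) X)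
    (Q : PowerSeries (PadicComplexInt p))
    (hupper : Ideal.span {Q} ≤ (Module.charIdeal (IwasawaAlgebra p) X).map (PowerSeries.map (R1.toCpInt p)))
    (hunit : ∃ m ≤ lambdaInvariant p X, ‖((PowerSeries.coeff m Q : PadicComplexInt p) : ℂ_[p])‖ = 1) :
    ∃ g : IwasawaAlgebra p,
      (Module.charIdeal (IwasawaAlgebra p) X).map (PowerSeries.map (R1.toCpInt p)) =
          Ideal.span {PowerSeries.map (R1.toCpInt p) g} ∧
        PowerSeries.map (residue (PadicComplexInt p)) Q ≠ 0 ∧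
        (PowerSeries.map (residue (PadicComplexInt p)) Q).order = lambdaInvariant p X ∧
        (PowerSeries.map (residue (PadicComplexInt p)) (PowerSeries.map (R1.toCpInt p) g)).order =
          lambdaInvariant p X := by
  obtain ⟨g₀, hchar, _hg₀, hord⟩ := exists_charIdeal_eq_span_C_pow_mu_mul (p := p) X hX
  set g : IwasawaAlgebra p := (PowerSeries.C ((p : ℤ_[p]) ^ muInvariant p X) : IwasawaAlgebra p) * g₀ with hg
  refine ⟨g, ?_, ?_⟩
  · rw [hchar, Ideal.map_span, Set.image_singleton]
  have hQmem : Q ∈ (Ideal.span {g}).map (PowerSeries.map (R1.toCpInt p)) := by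
    rw [← hchar]
    exact hupper (Ideal.mem_span_singleton_self Q)
  -- `ord ḡ ≤ ord Q̄` (upper inclusion) and `λ(X) ≤ ord ḡ` (shape of the characteristic generator)
  have h1 : (PowerSeries.map (residue ℤ_[p]) g).order ≤ (PowerSeries.map (residue (PadicComplexInt p)) Q).order :=
    le_order_map_residue_of_mem_map_span (R1.toCpInt p) (toCpInt_mem_maximalIdeal_iff (p := p)) hQmem
  have h2 : (lambdaInvariant p X : ℕ∞) ≤ (PowerSeries.map (residue ℤ_[p]) g).order := by
    rw [hg, map_mul, ← hord]
    exact le_trans le_add_self (PowerSeries.le_order_mul _ _)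
  -- `ord Q̄ ≤ m ≤ λ(X)` (the unit coefficient)
  obtain ⟨m, hm, hnorm⟩ := hunit
  have hmunit : IsUnit (PowerSeries.coeff m Q) := (norm_eq_one_iff_isUnit _).mp hnorm
  obtain ⟨hQ0, hQle⟩ :=
    Literature.RingTheory.PowerSeries.map_residue_ne_zero_and_order_le_of_isUnit_coeff hmunit
  have hm' : (m : ℕ∞) ≤ (lambdaInvariant p X : ℕ∞) := by exact_mod_cast hm
  have hgt : (PowerSeries.map (residue (PadicComplexInt p)) (PowerSeries.map (R1.toCpInt p) g)).order =
      (PowerSeries.map (residue ℤ_[p]) g).order :=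
    Literature.RingTheory.PowerSeries.order_map_residue_map_eq_of_mem_maximalIdeal_iff (R1.toCpInt p)
      (toCpInt_mem_maximalIdeal_iff (p := p)) g
  refine ⟨hQ0, le_antisymm (hQle.trans hm') (h2.trans h1), ?_⟩
  rw [hgt]
  exact le_antisymm (h1.trans (hQle.trans hm')) h2

/-- **UPPER ∧ (AN′) ⟹ LOWER.** For a finitely generated torsion `Λ = ℤ_p⟦T⟧`-module `X` and `Q ∈ 𝓞_{ℂ_p}⟦T⟧`: if
`(Q) ⊆ Ch_Λ(X)·𝓞_{ℂ_p}⟦T⟧` (the Euler-system / Kolyvagin direction of a main conjecture) and some coefficient `Q_m` with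
`m ≤ λ(X)` is a unit («`μ(Q) = 0` and `λ(Q) ≤ λ(X)`»), then `Ch_Λ(X)·𝓞_{ℂ_p}⟦T⟧ ⊆ (Q)` — the reverse (Eisenstein) inclusion.
Proof: by `order_map_residue_eq_of_span_le_of_norm_coeff_eq_one` the generator of the extended characteristic ideal and `Q`
have the same residual order and `Q̄ ≠ 0`; a divisor with the same residual order is an associate
(`span_singleton_le_of_le_of_order_map_residue_eq`). This is the «one divisibility + equal `λ`, `μ` ⟹ equality» step of
Greenberg–Vatsal / Castella–Grossi–Lee–Skinner, in the direction that PRODUCES the Eisenstein inclusion; no `μ(X) = 0`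
hypothesis. [cite: CastellaGrossiLeeSkinner2022, proof of Thm. 5.1.1 (arXiv:2008.02571 p. 23)] [cite: GreenbergVatsal2000, Thm. (1.3)] -/
theorem map_charIdeal_le_span_of_span_le_of_norm_coeff_eq_one (X : Type*) [AddCommGroup X]
    [Module (IwasawaAlgebra p) X] [Module.Finite (IwasawaAlgebra p) X] (hX : Module.IsTorsion (IwasawaAlgebra p) X)
    (Q : PowerSeries (PadicComplexInt p))
    (hupper : Ideal.span {Q} ≤ (Module.charIdeal (IwasawaAlgebra p) X).map (PowerSeries.map (R1.toCpInt p)))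
    (hunit : ∃ m ≤ lambdaInvariant p X, ‖((PowerSeries.coeff m Q : PadicComplexInt p) : ℂ_[p])‖ = 1) :
    (Module.charIdeal (IwasawaAlgebra p) X).map (PowerSeries.map (R1.toCpInt p)) ≤ Ideal.span {Q} := by
  obtain ⟨g, hmap, hQ0, hordQ, hordg⟩ :=
    order_map_residue_eq_of_span_le_of_norm_coeff_eq_one X hX Q hupper hunit
  rw [hmap] at hupper ⊢
  exact Literature.RingTheory.PowerSeries.span_singleton_le_of_le_of_order_map_residue_eq hupper hQ0
    (hordg.trans hordQ.symm)

/-- **UPPER ∧ (AN′) ⟹ EQUALITY** `Ch_Λ(X)·𝓞_{ℂ_p}⟦T⟧ = (Q)` (the main-conjecture equality over `𝓞_{ℂ_p}⟦T⟧`).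
[cite: CastellaGrossiLeeSkinner2022, proof of Thm. 5.1.1 (arXiv:2008.02571 p. 23)] [cite: GreenbergVatsal2000, Thm. (1.3)] -/
theorem map_charIdeal_eq_span_of_span_le_of_norm_coeff_eq_one (X : Type*) [AddCommGroup X]
    [Module (IwasawaAlgebra p) X] [Module.Finite (IwasawaAlgebra p) X] (hX : Module.IsTorsion (IwasawaAlgebra p) X)
    (Q : PowerSeries (PadicComplexInt p))
    (hupper : Ideal.span {Q} ≤ (Module.charIdeal (IwasawaAlgebra p) X).map (PowerSeries.map (R1.toCpInt p)))
    (hunit : ∃ m ≤ lambdaInvariant p X, ‖((PowerSeries.coeff m Q : PadicComplexInt p) : ℂ_[p])‖ = 1) :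
    (Module.charIdeal (IwasawaAlgebra p) X).map (PowerSeries.map (R1.toCpInt p)) = Ideal.span {Q} :=
  le_antisymm (map_charIdeal_le_span_of_span_le_of_norm_coeff_eq_one X hX Q hupper hunit) hupper

/-- **Under UPPER ∧ (AN′), `ord Q̄ = λ(X)`** — in particular `μ(Q) = 0`, `λ(Q) = λ(X)`, and (since the ideals agree)
`μ(X) = 0`: the hypothesis (AN′) is exactly the invariant MATCH, not weaker. [cite: GreenbergVatsal2000, §1 p. 18, (1)–(2) and Thm. (1.3)] -/
theorem order_map_residue_eq_lambdaInvariant_of_span_le_of_norm_coeff_eq_one (X : Type*) [AddCommGroup X]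
    [Module (IwasawaAlgebra p) X] [Module.Finite (IwasawaAlgebra p) X] (hX : Module.IsTorsion (IwasawaAlgebra p) X)
    (Q : PowerSeries (PadicComplexInt p))
    (hupper : Ideal.span {Q} ≤ (Module.charIdeal (IwasawaAlgebra p) X).map (PowerSeries.map (R1.toCpInt p)))
    (hunit : ∃ m ≤ lambdaInvariant p X, ‖((PowerSeries.coeff m Q : PadicComplexInt p) : ℂ_[p])‖ = 1) :
    (PowerSeries.map (residue (PadicComplexInt p)) Q).order = lambdaInvariant p X :=
  (order_map_residue_eq_of_span_le_of_norm_coeff_eq_one X hX Q hupper hunit).choose_spec.2.2.1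

/-- **Under UPPER, the unit coefficient of (AN′) is necessarily the `λ(X)`-th one**: `‖Q_{λ(X)}‖ = 1`. So on the locus of the
upper inclusion (AN′) ⟺ «the `λ(X_(∅,0))`-th coefficient of the ♭-BDP frame is a unit».
[cite: GreenbergVatsal2000, §1 p. 18, (1)–(2)] -/
theorem norm_coeff_lambdaInvariant_eq_one_of_span_le_of_norm_coeff_eq_one (X : Type*) [AddCommGroup X]
    [Module (IwasawaAlgebra p) X] [Module.Finite (IwasawaAlgebra p) X] (hX : Module.IsTorsion (IwasawaAlgebra p) X)
    (Q : PowerSeries (PadicComplexInt p))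
    (hupper : Ideal.span {Q} ≤ (Module.charIdeal (IwasawaAlgebra p) X).map (PowerSeries.map (R1.toCpInt p)))
    (hunit : ∃ m ≤ lambdaInvariant p X, ‖((PowerSeries.coeff m Q : PadicComplexInt p) : ℂ_[p])‖ = 1) :
    ‖((PowerSeries.coeff (lambdaInvariant p X) Q : PadicComplexInt p) : ℂ_[p])‖ = 1 :=
  (norm_eq_one_iff_isUnit _).mpr
    (Literature.RingTheory.PowerSeries.isUnit_coeff_of_order_map_residue_eq
      (order_map_residue_eq_lambdaInvariant_of_span_le_of_norm_coeff_eq_one X hX Q hupper hunit))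

/-- **(AN′) ⟸ the MIRROR Greenberg–Vatsal data** (pure residual-order arithmetic; `X` enters only through a number `lam`):
a congruence `Q ≡ u·L₁·L₂ (mod 𝔪)` with `u` a unit, residual-order UPPER bounds `ord L̄₁ ≤ n₁`, `ord L̄₂ ≤ n₂` (e.g. Rubin's
`GL₁` EQUALITY for two characters with `μ = 0`: `ord L̄ᵢ = λ(X_{θᵢ})`), and `n₁ + n₂ ≤ lam` (e.g. the EXACT residual devissage
`λ(X_(∅,0)) = λ(θ₁) + λ(θ₂)`) give a unit coefficient `Q_m` with `m ≤ lam` (`ord Q̄ = ord L̄₁ + ord L̄₂ ≤ lam`, w2 g3's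
`order_map_residue_eq_add_of_congr_unit_mul`). [cite: GreenbergVatsal2000, Thm. (1.3) and (17)] [cite: CastellaGrossiLeeSkinner2022, §3.3 (arXiv:2008.02571)] -/
theorem exists_norm_coeff_eq_one_of_congr_of_order_le {lam : ℕ} {Q u L₁ L₂ : PowerSeries (PadicComplexInt p)}
    (hu : IsUnit u) (hcong : ∀ n, PowerSeries.coeff n Q - PowerSeries.coeff n (u * L₁ * L₂) ∈ maximalIdeal (PadicComplexInt p))
    {n₁ n₂ : ℕ} (h₁ : (PowerSeries.map (residue (PadicComplexInt p)) L₁).order ≤ n₁)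
    (h₂ : (PowerSeries.map (residue (PadicComplexInt p)) L₂).order ≤ n₂) (hlam : n₁ + n₂ ≤ lam) :
    ∃ m ≤ lam, ‖((PowerSeries.coeff m Q : PadicComplexInt p) : ℂ_[p])‖ = 1 := by
  have hord := Literature.RingTheory.PowerSeries.order_map_residue_eq_add_of_congr_unit_mul hu hcong
  have hle : (PowerSeries.map (residue (PadicComplexInt p)) Q).order ≤ ((n₁ + n₂ : ℕ) : ℕ∞) := by
    rw [hord, Nat.cast_add]
    exact add_le_add h₁ h₂
  have hne : (PowerSeries.map (residue (PadicComplexInt p)) Q).order ≠ ⊤ :=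
    ne_top_of_le_ne_top (ENat.coe_ne_top _) hle
  obtain ⟨m, hm⟩ := ENat.ne_top_iff_exists.mp hne
  refine ⟨m, ?_, (norm_eq_one_iff_isUnit _).mpr
    (Literature.RingTheory.PowerSeries.isUnit_coeff_of_order_map_residue_eq hm.symm)⟩
  have : (m : ℕ∞) ≤ ((n₁ + n₂ : ℕ) : ℕ∞) := by rw [hm]; exact hle
  exact le_trans (by exact_mod_cast this) hlam

end Generic

/-! ## §2 On the crux binders: β1 VERBATIM ⟸ UPPER ∧ (AN′); the ♭-IMC equality; (AN′) ⟸ mirror GV data; END STATE -/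

/-- **REGISTERED β1 `stub_flatEisensteinIncl_cmRamified` (v4 = v5, signature VERBATIM as conclusion) ⟸ UPPER ∧ (AN′) at every
frame.** Inputs, per CM-ramified row / Heegner field `K''` / anticyclotomic frame / ♭-BDP frame `Q`: the UPPER inclusion
`(Q) ⊆ Ch_Λ(X_(∅,0)(W/K''_∞) at 𝔭′)·𝓞_{ℂ_p}⟦T⟧` (the Kolyvagin direction — research at `p² ∣ N`) and (AN′)
`∃ m ≤ λ(X_(∅,0)), ‖Q_m‖ = 1` (research: the (an-inv) congruence + `GL₁` + exact devissage). β1's own torsion guard and the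
tree's `moduleFinite_XAc_empty` feed §1. CONDITIONAL; no named fact used; BSD is not proved by any of this.
[cite: CastellaGrossiLeeSkinner2022, Thm. 3.2.1 and proof of Thm. 5.1.1 (arXiv:2008.02571 pp. 4, 23)] [cite: GreenbergVatsal2000, Thm. (1.3)] -/
theorem stub_flatEisensteinIncl_cmRamified_of_upperIncl_of_unitCoeff
    (hupper : ∀ (p : ℕ) [Fact p.Prime] (W : WeierstrassCurve ℚ) [W.IsElliptic] [W.IsGloballyMinimal],
      W.HasCM → CMRamified W p → 5 ≤ p → W.analyticRank = 1 →
      ∀ (N : ℕ) [NeZero N] (K : Type) [Field K] [NumberField K] (Dt : ModularParametrizationData W N),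
      W.conductorNorm ℤ = N → IsImaginaryQuadratic K → SatisfiesHeegnerHypothesis N K →
      ∀ (κ : ZpExtension K p), κ.IsAnticyclotomic → ∀ (γ : Field.absoluteGaloisGroup K) [Fact (κ.IsTopGenerator γ)]
        (𝔭 : HeightOneSpectrum (𝓞 K)), ((p : ℕ) : 𝓞 K) ∈ 𝔭.asIdeal → 𝔭.asIdeal.ramificationIdx (𝓞 ℚ) = 1 →
        𝔭.asIdeal.inertiaDeg (𝓞 ℚ) = 1 → ∀ (𝔭' : HeightOneSpectrum (𝓞 K)), ((p : ℕ) : 𝓞 K) ∈ 𝔭'.asIdeal → 𝔭' ≠ 𝔭 →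
        ∀ (ι' : PadicAlgCl p ≃+* ℂ), SchneiderFree.BranchInducesPrime p ι' 𝔭 →
        ∀ (ΩK : ℂ) (Ωp : ℂ_[p]) (Q : PowerSeries (PadicComplexInt p)), ΩK ≠ 0 → Ωp ≠ 0 →
          R1.IsBDPLFunctionInt p ι' 𝔭 κ γ Dt.f ΩK Ωp Q →
          Ideal.span {Q} ≤ (XAc.charIdeal (W.baseChange K) p κ 𝔭' ∅ γ).map (PowerSeries.map (R1.toCpInt p)))
    (hunit : ∀ (p : ℕ) [Fact p.Prime] (W : WeierstrassCurve ℚ) [W.IsElliptic] [W.IsGloballyMinimal],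
      W.HasCM → CMRamified W p → 5 ≤ p → W.analyticRank = 1 →
      ∀ (N : ℕ) [NeZero N] (K : Type) [Field K] [NumberField K] (Dt : ModularParametrizationData W N),
      W.conductorNorm ℤ = N → IsImaginaryQuadratic K → SatisfiesHeegnerHypothesis N K →
      ∀ (κ : ZpExtension K p), κ.IsAnticyclotomic → ∀ (γ : Field.absoluteGaloisGroup K) [Fact (κ.IsTopGenerator γ)]
        (𝔭 : HeightOneSpectrum (𝓞 K)), ((p : ℕ) : 𝓞 K) ∈ 𝔭.asIdeal → 𝔭.asIdeal.ramificationIdx (𝓞 ℚ) = 1 →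
        𝔭.asIdeal.inertiaDeg (𝓞 ℚ) = 1 → ∀ (𝔭' : HeightOneSpectrum (𝓞 K)), ((p : ℕ) : 𝓞 K) ∈ 𝔭'.asIdeal → 𝔭' ≠ 𝔭 →
        ∀ (ι' : PadicAlgCl p ≃+* ℂ), SchneiderFree.BranchInducesPrime p ι' 𝔭 →
        ∀ (ΩK : ℂ) (Ωp : ℂ_[p]) (Q : PowerSeries (PadicComplexInt p)), ΩK ≠ 0 → Ωp ≠ 0 →
          R1.IsBDPLFunctionInt p ι' 𝔭 κ γ Dt.f ΩK Ωp Q →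
          ∃ m ≤ lambdaInvariant p (XAc (W.baseChange K) p κ 𝔭' ∅ γ),
            ‖((PowerSeries.coeff m Q : PadicComplexInt p) : ℂ_[p])‖ = 1) :
    ∀ (p : ℕ) [Fact p.Prime] (W : WeierstrassCurve ℚ) [W.IsElliptic] [W.IsGloballyMinimal],
      W.HasCM → CMRamified W p → 5 ≤ p → W.analyticRank = 1 →
      ∀ (N : ℕ) [NeZero N] (K : Type) [Field K] [NumberField K] (Dt : ModularParametrizationData W N),
      W.conductorNorm ℤ = N → IsImaginaryQuadratic K → SatisfiesHeegnerHypothesis N K →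
      ∀ (κ : ZpExtension K p), κ.IsAnticyclotomic → ∀ (γ : Field.absoluteGaloisGroup K) [Fact (κ.IsTopGenerator γ)]
        (𝔭 : HeightOneSpectrum (𝓞 K)), ((p : ℕ) : 𝓞 K) ∈ 𝔭.asIdeal → 𝔭.asIdeal.ramificationIdx (𝓞 ℚ) = 1 →
        𝔭.asIdeal.inertiaDeg (𝓞 ℚ) = 1 → ∀ (𝔭' : HeightOneSpectrum (𝓞 K)), ((p : ℕ) : 𝓞 K) ∈ 𝔭'.asIdeal → 𝔭' ≠ 𝔭 →
        ∀ (ι' : PadicAlgCl p ≃+* ℂ), SchneiderFree.BranchInducesPrime p ι' 𝔭 →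
        ∀ (ΩK : ℂ) (Ωp : ℂ_[p]) (Q : PowerSeries (PadicComplexInt p)), ΩK ≠ 0 → Ωp ≠ 0 →
          R1.IsBDPLFunctionInt p ι' 𝔭 κ γ Dt.f ΩK Ωp Q →
          Module.IsTorsion (IwasawaAlgebra p) (XAc (W.baseChange K) p κ 𝔭' ∅ γ) →
          (XAc.charIdeal (W.baseChange K) p κ 𝔭' ∅ γ).map (PowerSeries.map (R1.toCpInt p)) ≤ Ideal.span {Q} := by
  intro p _ W _ _ hCM hram h5 hr N _ K _ _ Dt hN hK hHN κ hκ γ _ 𝔭 h𝔭 he hf 𝔭' h𝔭' hne ι' hind ΩK Ωp Q hΩK hΩp hBDP htors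
  have hle := hupper p W hCM hram h5 hr N K Dt hN hK hHN κ hκ γ 𝔭 h𝔭 he hf 𝔭' h𝔭' hne ι' hind ΩK Ωp Q hΩK hΩp hBDP
  have hu := hunit p W hCM hram h5 hr N K Dt hN hK hHN κ hκ γ 𝔭 h𝔭 he hf 𝔭' h𝔭' hne ι' hind ΩK Ωp Q hΩK hΩp hBDP
  haveI : (W.baseChange K).IsElliptic := by rw [WeierstrassCurve.baseChange]; infer_instance
  haveI := moduleFinite_XAc_empty (W.baseChange K) κ 𝔭' γ (p := p)
  exact map_charIdeal_le_span_of_span_le_of_norm_coeff_eq_one (XAc (W.baseChange K) p κ 𝔭' ∅ γ) htors Q hle hu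

/-- **(AN′) on the crux binders ⟸ the MIRROR Greenberg–Vatsal data at every frame**: a congruence `Q ≡ u·L₁·L₂ (mod 𝔪)` of the
♭-BDP frame with a unit `u` and two auxiliary power series (e.g. the Katz–character functions of `χ_d ω^{(p+1)/4}`,
`χ_d ω^{(3p−1)/4}` over `K''`), residual-order UPPER bounds `ord L̄ᵢ ≤ nᵢ` (Rubin's `GL₁` equality + `μ = 0` reads
`ord L̄ᵢ = λ(X_{θᵢ})`), and the reverse algebraic inequality `n₁ + n₂ ≤ λ(X_(∅,0))` (the EXACT residual devissage, CGLS
§1.2/§3.3). No named fact is used: the three inputs are displayed as ONE per-frame hypothesis (compare the LEAD's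
`stub_analyticInequality_cmRamified_of_GV`, p625921, which is the same display with the inequalities reversed).
[cite: GreenbergVatsal2000, Thm. (1.3) and (17)] [cite: CastellaGrossiLeeSkinner2022, §3.3 (arXiv:2008.02571)] -/
theorem unitCoeff_cmRamified_of_GVMirror
    (hGV : ∀ (p : ℕ) [Fact p.Prime] (W : WeierstrassCurve ℚ) [W.IsElliptic] [W.IsGloballyMinimal],
      W.HasCM → CMRamified W p → 5 ≤ p → W.analyticRank = 1 →
      ∀ (N : ℕ) [NeZero N] (K : Type) [Field K] [NumberField K] (Dt : ModularParametrizationData W N),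
      W.conductorNorm ℤ = N → IsImaginaryQuadratic K → SatisfiesHeegnerHypothesis N K →
      ∀ (κ : ZpExtension K p), κ.IsAnticyclotomic → ∀ (γ : Field.absoluteGaloisGroup K) [Fact (κ.IsTopGenerator γ)]
        (𝔭 : HeightOneSpectrum (𝓞 K)), ((p : ℕ) : 𝓞 K) ∈ 𝔭.asIdeal → 𝔭.asIdeal.ramificationIdx (𝓞 ℚ) = 1 →
        𝔭.asIdeal.inertiaDeg (𝓞 ℚ) = 1 → ∀ (𝔭' : HeightOneSpectrum (𝓞 K)), ((p : ℕ) : 𝓞 K) ∈ 𝔭'.asIdeal → 𝔭' ≠ 𝔭 →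
        ∀ (ι' : PadicAlgCl p ≃+* ℂ), SchneiderFree.BranchInducesPrime p ι' 𝔭 →
        ∀ (ΩK : ℂ) (Ωp : ℂ_[p]) (Q : PowerSeries (PadicComplexInt p)), ΩK ≠ 0 → Ωp ≠ 0 →
          R1.IsBDPLFunctionInt p ι' 𝔭 κ γ Dt.f ΩK Ωp Q →
          ∃ (u L₁ L₂ : PowerSeries (PadicComplexInt p)) (n₁ n₂ : ℕ), IsUnit u ∧
            (∀ n, PowerSeries.coeff n Q - PowerSeries.coeff n (u * L₁ * L₂) ∈ maximalIdeal (PadicComplexInt p)) ∧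
            (PowerSeries.map (residue (PadicComplexInt p)) L₁).order ≤ n₁ ∧
            (PowerSeries.map (residue (PadicComplexInt p)) L₂).order ≤ n₂ ∧
            n₁ + n₂ ≤ lambdaInvariant p (XAc (W.baseChange K) p κ 𝔭' ∅ γ)) :
    ∀ (p : ℕ) [Fact p.Prime] (W : WeierstrassCurve ℚ) [W.IsElliptic] [W.IsGloballyMinimal],
      W.HasCM → CMRamified W p → 5 ≤ p → W.analyticRank = 1 →
      ∀ (N : ℕ) [NeZero N] (K : Type) [Field K] [NumberField K] (Dt : ModularParametrizationData W N),
      W.conductorNorm ℤ = N → IsImaginaryQuadratic K → SatisfiesHeegnerHypothesis N K →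
      ∀ (κ : ZpExtension K p), κ.IsAnticyclotomic → ∀ (γ : Field.absoluteGaloisGroup K) [Fact (κ.IsTopGenerator γ)]
        (𝔭 : HeightOneSpectrum (𝓞 K)), ((p : ℕ) : 𝓞 K) ∈ 𝔭.asIdeal → 𝔭.asIdeal.ramificationIdx (𝓞 ℚ) = 1 →
        𝔭.asIdeal.inertiaDeg (𝓞 ℚ) = 1 → ∀ (𝔭' : HeightOneSpectrum (𝓞 K)), ((p : ℕ) : 𝓞 K) ∈ 𝔭'.asIdeal → 𝔭' ≠ 𝔭 →
        ∀ (ι' : PadicAlgCl p ≃+* ℂ), SchneiderFree.BranchInducesPrime p ι' 𝔭 →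
        ∀ (ΩK : ℂ) (Ωp : ℂ_[p]) (Q : PowerSeries (PadicComplexInt p)), ΩK ≠ 0 → Ωp ≠ 0 →
          R1.IsBDPLFunctionInt p ι' 𝔭 κ γ Dt.f ΩK Ωp Q →
          ∃ m ≤ lambdaInvariant p (XAc (W.baseChange K) p κ 𝔭' ∅ γ),
            ‖((PowerSeries.coeff m Q : PadicComplexInt p) : ℂ_[p])‖ = 1 := by
  intro p _ W _ _ hCM hram h5 hr N _ K _ _ Dt hN hK hHN κ hκ γ _ 𝔭 h𝔭 he hf 𝔭' h𝔭' hne ι' hind ΩK Ωp Q hΩK hΩp hBDP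
  obtain ⟨u, L₁, L₂, n₁, n₂, hu, hcong, h₁, h₂, hlam⟩ :=
    hGV p W hCM hram h5 hr N K Dt hN hK hHN κ hκ γ 𝔭 h𝔭 he hf 𝔭' h𝔭' hne ι' hind ΩK Ωp Q hΩK hΩp hBDP
  exact exists_norm_coeff_eq_one_of_congr_of_order_le hu hcong h₁ h₂ hlam

/-- **END STATE (v5 registry), KOLYVAGIN SIDE, BY NAME: C2 `PrintCFram.BottomClassIndexLawFiveLe` ⟸ the seven refereed
facts of `stub_prints` (v5) ∧ CGLS 2022 Prop. 14 (`stub_residualCharacterSelmerFinite`) ∧ UPPER ∧ (AN′).** Neither registered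
research stub is assumed: β1 is supplied by `stub_flatEisensteinIncl_cmRamified_of_upperIncl_of_unitCoeff` (this file) and
(AN) by the LEAD's `stub_analyticInequality_cmRamified_of_prop14_of_upperIncl` (p625921), both from UPPER (∧ (AN′)); the
LEAD's v5 end state `bottomClassIndexLawFiveLe_of_prints7_of_prop14_of_flatIncl_of_analyticInequality` (p626319: four of
v4's eleven citations are theorems of the tree) concludes the crux literally. So on the CM-ramified rows the crux follows from
print plus {the Euler-system inclusion of the ♭-(∅,0)
main conjecture for `f_W/K''`, one unit coefficient of `L_𝔭^{BDP}(f_W/K'')` in degree `≤ λ(X_(∅,0))`} — the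
Castella–Grossi–Lee–Skinner shape (one divisibility + invariant match), with no Eisenstein-side engine. CONDITIONAL; nothing
booked; BSD is not proved by any of this; no summit statement is proved by this seat.
[cite: CastellaGrossiLeeSkinner2022, §1.2 Prop. 14, Thm. 3.2.1, Thm. 5.1.1 (arXiv:2008.02571)] [cite: GreenbergVatsal2000, Thm. 1.3]
[cite: JetchevSkinnerWan2017, §7.4.1 (arXiv:1512.06894 p. 30)] -/
theorem bottomClassIndexLawFiveLe_of_prints_of_prop14_of_upperIncl_of_unitCoeff
    (h7 : Hsieh2014.thmA_exists_isHsiehLFunction_unrPeriod_anyLevel ∧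
      LiuZhangZhang2018.thm151_thm153_modularCurve_heegnerVector_additive ∧
      ToricPublishedInputs ∧
      (∀ (K : Type) [Field K] [NumberField K], poitouTate_sha_tateDual K) ∧
      bsdTriple_of_hasCM_of_L_one_ne_zero ∧
      hasEntireLFunction_rat ∧
      bsdRHS_eq_of_isIsogenous)
    (hfact : CastellaGrossiLeeSkinner2022.prop14_residualCharacterSelmer_finite)
    (hupper : ∀ (p : ℕ) [Fact p.Prime] (W : WeierstrassCurve ℚ) [W.IsElliptic] [W.IsGloballyMinimal],
      W.HasCM → CMRamified W p → 5 ≤ p → W.analyticRank = 1 →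
      ∀ (N : ℕ) [NeZero N] (K : Type) [Field K] [NumberField K] (Dt : ModularParametrizationData W N),
      W.conductorNorm ℤ = N → IsImaginaryQuadratic K → SatisfiesHeegnerHypothesis N K →
      ∀ (κ : ZpExtension K p), κ.IsAnticyclotomic → ∀ (γ : Field.absoluteGaloisGroup K) [Fact (κ.IsTopGenerator γ)]
        (𝔭 : HeightOneSpectrum (𝓞 K)), ((p : ℕ) : 𝓞 K) ∈ 𝔭.asIdeal → 𝔭.asIdeal.ramificationIdx (𝓞 ℚ) = 1 →
        𝔭.asIdeal.inertiaDeg (𝓞 ℚ) = 1 → ∀ (𝔭' : HeightOneSpectrum (𝓞 K)), ((p : ℕ) : 𝓞 K) ∈ 𝔭'.asIdeal → 𝔭' ≠ 𝔭 →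
        ∀ (ι' : PadicAlgCl p ≃+* ℂ), SchneiderFree.BranchInducesPrime p ι' 𝔭 →
        ∀ (ΩK : ℂ) (Ωp : ℂ_[p]) (Q : PowerSeries (PadicComplexInt p)), ΩK ≠ 0 → Ωp ≠ 0 →
          R1.IsBDPLFunctionInt p ι' 𝔭 κ γ Dt.f ΩK Ωp Q →
          Ideal.span {Q} ≤ (XAc.charIdeal (W.baseChange K) p κ 𝔭' ∅ γ).map (PowerSeries.map (R1.toCpInt p)))
    (hunit : ∀ (p : ℕ) [Fact p.Prime] (W : WeierstrassCurve ℚ) [W.IsElliptic] [W.IsGloballyMinimal],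
      W.HasCM → CMRamified W p → 5 ≤ p → W.analyticRank = 1 →
      ∀ (N : ℕ) [NeZero N] (K : Type) [Field K] [NumberField K] (Dt : ModularParametrizationData W N),
      W.conductorNorm ℤ = N → IsImaginaryQuadratic K → SatisfiesHeegnerHypothesis N K →
      ∀ (κ : ZpExtension K p), κ.IsAnticyclotomic → ∀ (γ : Field.absoluteGaloisGroup K) [Fact (κ.IsTopGenerator γ)]
        (𝔭 : HeightOneSpectrum (𝓞 K)), ((p : ℕ) : 𝓞 K) ∈ 𝔭.asIdeal → 𝔭.asIdeal.ramificationIdx (𝓞 ℚ) = 1 →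
        𝔭.asIdeal.inertiaDeg (𝓞 ℚ) = 1 → ∀ (𝔭' : HeightOneSpectrum (𝓞 K)), ((p : ℕ) : 𝓞 K) ∈ 𝔭'.asIdeal → 𝔭' ≠ 𝔭 →
        ∀ (ι' : PadicAlgCl p ≃+* ℂ), SchneiderFree.BranchInducesPrime p ι' 𝔭 →
        ∀ (ΩK : ℂ) (Ωp : ℂ_[p]) (Q : PowerSeries (PadicComplexInt p)), ΩK ≠ 0 → Ωp ≠ 0 →
          R1.IsBDPLFunctionInt p ι' 𝔭 κ γ Dt.f ΩK Ωp Q →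
          ∃ m ≤ lambdaInvariant p (XAc (W.baseChange K) p κ 𝔭' ∅ γ),
            ‖((PowerSeries.coeff m Q : PadicComplexInt p) : ℂ_[p])‖ = 1) :
    Summit.BirchSwinnertonDyer.BirchSwinnertonDyer.Theses.PrintCFram.BottomClassIndexLawFiveLe :=
  bottomClassIndexLawFiveLe_of_prints7_of_prop14_of_flatIncl_of_analyticInequality h7 hfact
    (stub_flatEisensteinIncl_cmRamified_of_upperIncl_of_unitCoeff hupper hunit)
    (stub_analyticInequality_cmRamified_of_prop14_of_upperIncl hfact hupper)

/-- **END STATE, KOLYVAGIN SIDE with the invariant match DISPLAYED: C2 ⟸ `stub_prints` ∧ CGLS Prop. 14 ∧ UPPER ∧ the mirror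
Greenberg–Vatsal data** (per frame: `Q ≡ u·L₁·L₂ (mod 𝔪)` with `u` a unit, `ord L̄ᵢ ≤ nᵢ`, `n₁ + n₂ ≤ λ(X_(∅,0))`) — the
previous end state with (AN′) supplied by `unitCoeff_cmRamified_of_GVMirror`. This is the literal shape of the printed
Castella–Grossi–Lee–Skinner argument («one divisibility + `λ(X_E) = λ(L_E)`, `μ = 0` ⟹ equality») on the CM-ramified rows,
its three beyond-print inputs displayed as hypotheses: UPPER (Kolyvagin at `p² ∣ N`), the Λ-adic congruence at `p² ∣ N`, and the
exact residual devissage / `GL₁` count. CONDITIONAL; nothing booked; BSD is not proved by any of this; no summit statement is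
proved by this seat. [cite: CastellaGrossiLeeSkinner2022, Thm. 3.2.1, §3.3, Thm. 5.1.1 (arXiv:2008.02571 pp. 4, 23)]
[cite: GreenbergVatsal2000, Thm. (1.3) and (17)] -/
theorem bottomClassIndexLawFiveLe_of_prints_of_prop14_of_upperIncl_of_GVMirror
    (h7 : Hsieh2014.thmA_exists_isHsiehLFunction_unrPeriod_anyLevel ∧
      LiuZhangZhang2018.thm151_thm153_modularCurve_heegnerVector_additive ∧
      ToricPublishedInputs ∧
      (∀ (K : Type) [Field K] [NumberField K], poitouTate_sha_tateDual K) ∧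
      bsdTriple_of_hasCM_of_L_one_ne_zero ∧
      hasEntireLFunction_rat ∧
      bsdRHS_eq_of_isIsogenous)
    (hfact : CastellaGrossiLeeSkinner2022.prop14_residualCharacterSelmer_finite)
    (hupper : ∀ (p : ℕ) [Fact p.Prime] (W : WeierstrassCurve ℚ) [W.IsElliptic] [W.IsGloballyMinimal],
      W.HasCM → CMRamified W p → 5 ≤ p → W.analyticRank = 1 →
      ∀ (N : ℕ) [NeZero N] (K : Type) [Field K] [NumberField K] (Dt : ModularParametrizationData W N),
      W.conductorNorm ℤ = N → IsImaginaryQuadratic K → SatisfiesHeegnerHypothesis N K →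
      ∀ (κ : ZpExtension K p), κ.IsAnticyclotomic → ∀ (γ : Field.absoluteGaloisGroup K) [Fact (κ.IsTopGenerator γ)]
        (𝔭 : HeightOneSpectrum (𝓞 K)), ((p : ℕ) : 𝓞 K) ∈ 𝔭.asIdeal → 𝔭.asIdeal.ramificationIdx (𝓞 ℚ) = 1 →
        𝔭.asIdeal.inertiaDeg (𝓞 ℚ) = 1 → ∀ (𝔭' : HeightOneSpectrum (𝓞 K)), ((p : ℕ) : 𝓞 K) ∈ 𝔭'.asIdeal → 𝔭' ≠ 𝔭 →
        ∀ (ι' : PadicAlgCl p ≃+* ℂ), SchneiderFree.BranchInducesPrime p ι' 𝔭 →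
        ∀ (ΩK : ℂ) (Ωp : ℂ_[p]) (Q : PowerSeries (PadicComplexInt p)), ΩK ≠ 0 → Ωp ≠ 0 →
          R1.IsBDPLFunctionInt p ι' 𝔭 κ γ Dt.f ΩK Ωp Q →
          Ideal.span {Q} ≤ (XAc.charIdeal (W.baseChange K) p κ 𝔭' ∅ γ).map (PowerSeries.map (R1.toCpInt p)))
    (hGV : ∀ (p : ℕ) [Fact p.Prime] (W : WeierstrassCurve ℚ) [W.IsElliptic] [W.IsGloballyMinimal],
      W.HasCM → CMRamified W p → 5 ≤ p → W.analyticRank = 1 →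
      ∀ (N : ℕ) [NeZero N] (K : Type) [Field K] [NumberField K] (Dt : ModularParametrizationData W N),
      W.conductorNorm ℤ = N → IsImaginaryQuadratic K → SatisfiesHeegnerHypothesis N K →
      ∀ (κ : ZpExtension K p), κ.IsAnticyclotomic → ∀ (γ : Field.absoluteGaloisGroup K) [Fact (κ.IsTopGenerator γ)]
        (𝔭 : HeightOneSpectrum (𝓞 K)), ((p : ℕ) : 𝓞 K) ∈ 𝔭.asIdeal → 𝔭.asIdeal.ramificationIdx (𝓞 ℚ) = 1 →
        𝔭.asIdeal.inertiaDeg (𝓞 ℚ) = 1 → ∀ (𝔭' : HeightOneSpectrum (𝓞 K)), ((p : ℕ) : 𝓞 K) ∈ 𝔭'.asIdeal → 𝔭' ≠ 𝔭 →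
        ∀ (ι' : PadicAlgCl p ≃+* ℂ), SchneiderFree.BranchInducesPrime p ι' 𝔭 →
        ∀ (ΩK : ℂ) (Ωp : ℂ_[p]) (Q : PowerSeries (PadicComplexInt p)), ΩK ≠ 0 → Ωp ≠ 0 →
          R1.IsBDPLFunctionInt p ι' 𝔭 κ γ Dt.f ΩK Ωp Q →
          ∃ (u L₁ L₂ : PowerSeries (PadicComplexInt p)) (n₁ n₂ : ℕ), IsUnit u ∧
            (∀ n, PowerSeries.coeff n Q - PowerSeries.coeff n (u * L₁ * L₂) ∈ maximalIdeal (PadicComplexInt p)) ∧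
            (PowerSeries.map (residue (PadicComplexInt p)) L₁).order ≤ n₁ ∧
            (PowerSeries.map (residue (PadicComplexInt p)) L₂).order ≤ n₂ ∧
            n₁ + n₂ ≤ lambdaInvariant p (XAc (W.baseChange K) p κ 𝔭' ∅ γ)) :
    Summit.BirchSwinnertonDyer.BirchSwinnertonDyer.Theses.PrintCFram.BottomClassIndexLawFiveLe :=
  bottomClassIndexLawFiveLe_of_prints_of_prop14_of_upperIncl_of_unitCoeff h7 hfact hupper
    (unitCoeff_cmRamified_of_GVMirror hGV)

end Summit.BirchSwinnertonDyer.BirchSwinnertonDyer.Theorems.PrintCFram.EisensteinKolyvaginSide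

end
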